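import Mathlib.Analysis.Fourier.ZMod
import Mathlib.Analysis.Complex.Trigonometric
import Mathlib.Data.Complex.BigOperators
import Mathlib.Algebra.BigOperators.Fin
import Literature.Computability.Cryptography.QubitRegister

/-!
# Crux `DlogGraphFlat` (stmt-QuantumAdvantage-10732), line `Sketch_holder_energy` — Riesz blocks

Stub `stub_heRieszBlock` (B4d of the line): the discrete Fourier transform on `ℤ/N` of a Walsh
sign `a(x) = (−1)^{α·bits(x)} = ∏ᵢ (−1)^{αᵢ xᵢ}` restricted to `x < N`, `N < 2ⁿ`, is bounded by a
sum of Riesz products: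
`‖𝓕a(k)‖ ≤ Σ_{j<n} Π_{i<j} ‖1 + sᵢ e(2^i θ_k)‖`, `sᵢ = (−1)^{αᵢ}`, `θ_k = (−k).val / N`,
`e(t) = exp(2πit)`.

Proof. With `u = e(θ_k)` one has `stdAddChar (−(x k)) = u ^ x.val`
(`heRieszBlock_stdAddChar_neg_mul_eq_pow`), so `𝓕a(k) = Σ_{m<N} a(m) uᵐ` after reindexing `ℤ/N`
by `[0, N)`. The core is the abstract dyadic estimate `heRieszBlock_block_bound`: if coefficients
`A n m` satisfy `A (n+1) m = A n m` and `A (n+1) (2ⁿ + m) = A n m · c n` for `m < 2ⁿ` (here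
`c n = sₙ`), then `Σ_{m<2^j} A j m uᵐ = Π_{i<j} (1 + cᵢ u^{2^i})` (the Riesz factorisation
`heRieszBlock_riesz_prod`, induction on `j`) and, for `‖u‖, ‖cᵢ‖ ≤ 1` and `N < 2ⁿ`,
`‖Σ_{m<N} A n m uᵐ‖ ≤ Σ_{j<n} Π_{i<j} ‖1 + cᵢ u^{2^i}‖`
(induction on `n`: if `N < 2^{n-1}` use the hypothesis; otherwise split `[0, N)` into the full block
`[0, 2^{n-1})`, which is exactly a Riesz product, and the translate `2^{n-1} + [0, N − 2^{n-1})`,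
whose sum is `c_{n-1} u^{2^{n-1}}` times a shorter sum). No new definitions.
-/

set_option linter.dupNamespace false -- D-0017: single-problem summit ⇒ `QuantumAdvantage.QuantumAdvantage` by design

namespace Summit.QuantumAdvantage.QuantumAdvantage.Theorems.SymplecticPurity

open scoped ZMod
open Finset Literature.Computability.Cryptography

/-! ### The abstract dyadic estimate -/

section Abstract

/-- Riesz factorisation: coefficients with the dyadic doubling rule sum over a full dyadic block
`[0, 2^j)` to the Riesz product `Π_{i<j} (1 + cᵢ u^{2^i})`. [folklore] -/
theorem heRieszBlock_riesz_prod (A : ℕ → ℕ → ℂ) (c : ℕ → ℂ) (u : ℂ) (h0 : A 0 0 = 1)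
    (h1 : ∀ n m, m < 2 ^ n → A (n + 1) m = A n m)
    (h2 : ∀ n m, m < 2 ^ n → A (n + 1) (2 ^ n + m) = A n m * c n) (j : ℕ) :
    ∑ m ∈ range (2 ^ j), A j m * u ^ m = ∏ i ∈ range j, (1 + c i * u ^ (2 ^ i)) := by
  induction j with
  | zero => simp [h0]
  | succ j ih =>
    have e1 : ∑ m ∈ range (2 ^ j), A (j + 1) m * u ^ m = ∑ m ∈ range (2 ^ j), A j m * u ^ m :=
      Finset.sum_congr rfl fun m hm => by rw [h1 j m (Finset.mem_range.1 hm)]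
    have e2 : ∑ m ∈ range (2 ^ j), A (j + 1) (2 ^ j + m) * u ^ (2 ^ j + m) =
        (c j * u ^ (2 ^ j)) * ∑ m ∈ range (2 ^ j), A j m * u ^ m := by
      rw [Finset.mul_sum]
      exact Finset.sum_congr rfl fun m hm => by
        rw [h2 j m (Finset.mem_range.1 hm), pow_add]; ring
    rw [pow_succ, mul_two, Finset.sum_range_add, e1, e2, ih, Finset.prod_range_succ]
    ring

/-- The dyadic block estimate: for `N < 2ⁿ`, the partial sum `Σ_{m<N} A n m uᵐ` of coefficients
with the dyadic doubling rule is bounded by the sum over `j < n` of the moduli of the Riesz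
products of length `j` (split `[0, N)` along the binary digits of `N`). [folklore] -/
theorem heRieszBlock_block_bound (A : ℕ → ℕ → ℂ) (c : ℕ → ℂ) (u : ℂ) (h0 : A 0 0 = 1)
    (h1 : ∀ n m, m < 2 ^ n → A (n + 1) m = A n m)
    (h2 : ∀ n m, m < 2 ^ n → A (n + 1) (2 ^ n + m) = A n m * c n)
    (hc : ∀ n, ‖c n‖ ≤ 1) (hu : ‖u‖ ≤ 1) (n : ℕ) :
    ∀ N, N < 2 ^ n → ‖∑ m ∈ range N, A n m * u ^ m‖ ≤
      ∑ j ∈ range n, ∏ i ∈ range j, ‖1 + c i * u ^ (2 ^ i)‖ := by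
  induction n with
  | zero =>
    intro N hN
    have hN0 : N = 0 := by rw [pow_zero] at hN; omega
    subst hN0
    simp
  | succ n ih =>
    intro N hN
    rcases lt_or_ge N (2 ^ n) with hlt | hle
    · calc ‖∑ m ∈ range N, A (n + 1) m * u ^ m‖ = ‖∑ m ∈ range N, A n m * u ^ m‖ := by
            congr 1
            exact Finset.sum_congr rfl fun m hm => by
              rw [h1 n m ((Finset.mem_range.1 hm).trans hlt)]
        _ ≤ ∑ j ∈ range n, ∏ i ∈ range j, ‖1 + c i * u ^ (2 ^ i)‖ := ih N hlt
        _ ≤ ∑ j ∈ range (n + 1), ∏ i ∈ range j, ‖1 + c i * u ^ (2 ^ i)‖ := by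
            rw [Finset.sum_range_succ]
            exact le_add_of_nonneg_right (Finset.prod_nonneg fun i _ => norm_nonneg _)
    · obtain ⟨N', rfl⟩ := Nat.exists_eq_add_of_le hle
      have hN' : N' < 2 ^ n := by rw [pow_succ] at hN; omega
      have e1 : ∑ m ∈ range (2 ^ n), A (n + 1) m * u ^ m =
          ∏ i ∈ range n, (1 + c i * u ^ (2 ^ i)) := by
        rw [← heRieszBlock_riesz_prod A c u h0 h1 h2 n]
        exact Finset.sum_congr rfl fun m hm => by rw [h1 n m (Finset.mem_range.1 hm)]
      have e2 : ∑ m ∈ range N', A (n + 1) (2 ^ n + m) * u ^ (2 ^ n + m) =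
          (c n * u ^ (2 ^ n)) * ∑ m ∈ range N', A n m * u ^ m := by
        rw [Finset.mul_sum]
        exact Finset.sum_congr rfl fun m hm => by
          rw [h2 n m ((Finset.mem_range.1 hm).trans hN'), pow_add]; ring
      rw [Finset.sum_range_add, e1, e2, Finset.sum_range_succ_comm]
      refine (norm_add_le _ _).trans (add_le_add (norm_prod _ _).le ?_)
      calc ‖c n * u ^ (2 ^ n) * ∑ m ∈ range N', A n m * u ^ m‖
          ≤ ‖∑ m ∈ range N', A n m * u ^ m‖ := by
            rw [norm_mul]
            refine mul_le_of_le_one_left (norm_nonneg _) ?_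
            rw [norm_mul]
            exact mul_le_one₀ (hc n) (norm_nonneg _)
              ((norm_pow _ _).le.trans (pow_le_one₀ (norm_nonneg _) hu))
        _ ≤ ∑ j ∈ range n, ∏ i ∈ range j, ‖1 + c i * u ^ (2 ^ i)‖ := ih N' hN'

end Abstract

/-! ### Walsh signs: the dyadic doubling rule -/

section Walsh

/-- Below `2ⁿ` the digit `n` is `0`, so the length-`(n+1)` Walsh sign is the length-`n` one.
[folklore] -/
theorem heRieszBlock_sign_succ_of_lt (σ : ℕ → Bool) {n m : ℕ} (hm : m < 2 ^ n) :
    ∏ i ∈ range (n + 1), (if σ i && m.testBit i then (-1 : ℂ) else 1) =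
      ∏ i ∈ range n, (if σ i && m.testBit i then (-1 : ℂ) else 1) := by
  rw [Finset.prod_range_succ, Nat.testBit_lt_two_pow hm, Bool.and_false]
  simp

/-- Adding `2ⁿ` to `m < 2ⁿ` sets the digit `n` and keeps the lower digits, so the
length-`(n+1)` Walsh sign of `2ⁿ + m` is the length-`n` sign of `m` times `(−1)^{σ n}`.
[folklore] -/
theorem heRieszBlock_sign_succ_two_pow_add (σ : ℕ → Bool) {n m : ℕ} (hm : m < 2 ^ n) :
    ∏ i ∈ range (n + 1), (if σ i && (2 ^ n + m).testBit i then (-1 : ℂ) else 1) =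
      (∏ i ∈ range n, (if σ i && m.testBit i then (-1 : ℂ) else 1)) *
        (if σ n then -1 else 1) := by
  rw [Finset.prod_range_succ, Nat.testBit_two_pow_add_eq m n, Nat.testBit_lt_two_pow hm]
  congr 1
  · refine Finset.prod_congr rfl fun i hi => ?_
    rw [Nat.testBit_two_pow_add_gt (Finset.mem_range.1 hi)]
  · simp

/-- **Partial Walsh sums are sums of Riesz products.** For `‖u‖ ≤ 1` and `N < 2ⁿ`,
`‖Σ_{m<N} (−1)^{σ·bits m} uᵐ‖ ≤ Σ_{j<n} Π_{i<j} ‖1 + (−1)^{σ i} u^{2^i}‖`. [folklore] -/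
theorem heRieszBlock_partialSum_norm_le (σ : ℕ → Bool) (u : ℂ) (hu : ‖u‖ ≤ 1) (n N : ℕ)
    (hN : N < 2 ^ n) :
    ‖∑ m ∈ range N, (∏ i ∈ range n, (if σ i && m.testBit i then (-1 : ℂ) else 1)) * u ^ m‖ ≤
      ∑ j ∈ range n, ∏ i ∈ range j, ‖1 + (if σ i then (-1 : ℂ) else 1) * u ^ (2 ^ i)‖ :=
  heRieszBlock_block_bound (fun n m => ∏ i ∈ range n, (if σ i && m.testBit i then (-1 : ℂ) else 1))
    (fun i => if σ i then -1 else 1) u (by simp) (fun _ _ hm => heRieszBlock_sign_succ_of_lt σ hm)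
    (fun _ _ hm => heRieszBlock_sign_succ_two_pow_add σ hm) (fun n => by split_ifs <;> simp)
    hu n N hN

end Walsh

/-! ### The discrete Fourier transform on `ℤ/N` -/

section Dft

variable {N : ℕ} [NeZero N]

/-- Reindexing a sum over `ℤ/N` as a sum over `[0, N)` (the bijection `ZMod.val`). [folklore] -/
theorem heRieszBlock_sum_zmod_val_eq_sum_range {M : Type*} [AddCommMonoid M] (f : ℕ → M) :
    ∑ x : ZMod N, f x.val = ∑ m ∈ range N, f m := by
  refine Finset.sum_nbij' (fun x => x.val) (fun m => (m : ZMod N)) ?_ ?_ ?_ ?_ ?_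
  · intro x _; exact Finset.mem_range.2 (ZMod.val_lt x)
  · intro m _; exact Finset.mem_univ _
  · intro x _; exact ZMod.natCast_zmod_val x
  · intro m hm; exact ZMod.val_cast_of_lt (Finset.mem_range.1 hm)
  · intro x _; rfl

/-- The kernel of the discrete Fourier transform as a power of `e(θ_k)`, `θ_k = (−k).val / N`:
`stdAddChar (−(x k)) = e(θ_k) ^ x.val`. [folklore] -/
theorem heRieszBlock_stdAddChar_neg_mul_eq_pow (x k : ZMod N) :
    (ZMod.stdAddChar (-(x * k)) : ℂ) =
      Complex.exp (2 * Real.pi * Complex.I * ((((-k).val : ℝ) / (N : ℝ) : ℝ) : ℂ)) ^ x.val := by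
  have hxk : -(x * k) = ((x.val * (-k).val : ℕ) : ZMod N) := by
    rw [Nat.cast_mul, ZMod.natCast_zmod_val, ZMod.natCast_zmod_val, mul_neg]
  rw [hxk, ZMod.stdAddChar_apply, ZMod.toCircle_natCast, ← Complex.exp_nat_mul]
  congr 1
  push_cast
  ring

/-- **The DFT of a restricted Walsh sign is a sum of Riesz products** (digit pattern
`σ : ℕ → Bool`): for `N < 2ⁿ`,
`‖𝓕 (x ↦ (−1)^{σ·bits(x.val)}) k‖ ≤ Σ_{j<n} Π_{i<j} ‖1 + (−1)^{σ i} e(2^i θ_k)‖`. [folklore] -/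
theorem heRieszBlock_norm_dft_le (n : ℕ) (hN : N < 2 ^ n) (σ : ℕ → Bool) (k : ZMod N) :
    ‖𝓕 (fun x : ZMod N => ∏ i ∈ range n, (if σ i && x.val.testBit i then (-1 : ℂ) else 1)) k‖ ≤
      ∑ j ∈ range n, ∏ i ∈ range j,
        ‖(1 : ℂ) + (if σ i then -1 else 1) *
          Complex.exp (2 * Real.pi * Complex.I *
            (((2 : ℝ) ^ i * (((-k).val : ℝ) / (N : ℝ)) : ℝ) : ℂ))‖ := by
  have hexp : ∀ i : ℕ, Complex.exp (2 * Real.pi * Complex.I *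
      (((2 : ℝ) ^ i * (((-k).val : ℝ) / (N : ℝ)) : ℝ) : ℂ)) =
      Complex.exp (2 * Real.pi * Complex.I * ((((-k).val : ℝ) / (N : ℝ) : ℝ) : ℂ)) ^ (2 ^ i) := by
    intro i
    rw [← Complex.exp_nat_mul]
    congr 1
    push_cast
    ring
  have hu : ‖Complex.exp (2 * Real.pi * Complex.I * ((((-k).val : ℝ) / (N : ℝ) : ℝ) : ℂ))‖ ≤ 1 := by
    rw [show (2 * Real.pi * Complex.I * ((((-k).val : ℝ) / (N : ℝ) : ℝ) : ℂ) : ℂ) =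
      ((2 * Real.pi * (((-k).val : ℝ) / (N : ℝ)) : ℝ) : ℂ) * Complex.I by push_cast; ring]
    exact (Complex.norm_exp_ofReal_mul_I _).le
  have hlhs :
      𝓕 (fun x : ZMod N => ∏ i ∈ range n, (if σ i && x.val.testBit i then (-1 : ℂ) else 1)) k =
        ∑ m ∈ range N, (∏ i ∈ range n, (if σ i && m.testBit i then (-1 : ℂ) else 1)) *
          Complex.exp (2 * Real.pi * Complex.I * ((((-k).val : ℝ) / (N : ℝ) : ℝ) : ℂ)) ^ m := by
    rw [ZMod.dft_apply]
    calc ∑ x : ZMod N, ZMod.stdAddChar (-(x * k)) •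
          (∏ i ∈ range n, (if σ i && x.val.testBit i then (-1 : ℂ) else 1))
        = ∑ x : ZMod N, (∏ i ∈ range n, (if σ i && x.val.testBit i then (-1 : ℂ) else 1)) *
            Complex.exp (2 * Real.pi * Complex.I * ((((-k).val : ℝ) / (N : ℝ) : ℝ) : ℂ)) ^
              x.val := by
          refine Finset.sum_congr rfl fun x _ => ?_
          rw [smul_eq_mul, mul_comm, heRieszBlock_stdAddChar_neg_mul_eq_pow]
      _ = _ := heRieszBlock_sum_zmod_val_eq_sum_range (fun m =>
            (∏ i ∈ range n, (if σ i && m.testBit i then (-1 : ℂ) else 1)) *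
              Complex.exp (2 * Real.pi * Complex.I * ((((-k).val : ℝ) / (N : ℝ) : ℝ) : ℂ)) ^ m)
  rw [hlhs]
  calc _ ≤ ∑ j ∈ range n, ∏ i ∈ range j, ‖1 + (if σ i then (-1 : ℂ) else 1) *
          Complex.exp (2 * Real.pi * Complex.I * ((((-k).val : ℝ) / (N : ℝ) : ℝ) : ℂ)) ^ (2 ^ i)‖ :=
        heRieszBlock_partialSum_norm_le σ _ hu n N hN
    _ = _ := by
        refine Finset.sum_congr rfl fun j _ => Finset.prod_congr rfl fun i _ => ?_
        rw [hexp i]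

end Dft

/-! ### The registered stub -/

/-- The Walsh sign of a register mask `α : QReg n`, as a complex number, is the digit-pattern sign
of the pattern `i ↦ α i` (extended by `false`). [folklore] -/
theorem heRieszBlock_sign_qReg_eq_range {n : ℕ} (α : QReg n) (m : ℕ) :
    (((∏ i : Fin n, (if α i && m.testBit (i : ℕ) then (-1 : ℝ) else 1) : ℝ) : ℂ)) =
      ∏ i ∈ range n,
        (if (if h : i < n then α ⟨i, h⟩ else false) && m.testBit i then (-1 : ℂ) else 1) := by
  rw [Finset.prod_range, Complex.ofReal_prod]
  refine Finset.prod_congr rfl fun i _ => ?_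
  rcases i with ⟨i, hi⟩
  simp only [dif_pos hi]
  split_ifs <;> simp

/-- **Stub B4d: the DFT of a Walsh sign restricted to `[0,N)` is a sum of Riesz products.**
For `N < 2ⁿ` and a mask `α`, with `a(x) = (−1)^{α·bits(x)}` on `x < N`:
`|𝓕a(k)| ≤ Σ_{j<n} Π_{i<j} |1 + (−1)^{α_i} e(2^i θ_k)|`, `θ_k = (−k).val/N`
(`𝓕a(k) = Σ_{x<N} a(x) e(x θ_k)`; split `[0,N)` into the dyadic blocks `[M_j, M_j + 2^j)` of the
binary digits of `N`, on which `a(M_j + y) = a(M_j) a(y)`; the block sum over `y < 2^j` factorises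
as the Riesz product `Π_{i<j} (1 + (−1)^{α_i} e(2^iθ))`; blocks for unset digits are added as
non-negative terms). Derived from `heRieszBlock_norm_dft_le` with the digit pattern of `α`. -/
theorem stub_heRieszBlock : ∀ (n N : ℕ) [NeZero N], N < 2 ^ n → ∀ (α : QReg n) (k : ZMod N),
    ‖ZMod.dft (fun x : ZMod N =>
        ((∏ i : Fin n, (if α i && x.val.testBit (i : ℕ) then (-1 : ℝ) else 1) : ℝ) : ℂ)) k‖ ≤
      ∑ j ∈ Finset.range n, ∏ i ∈ Finset.range j,
        ‖(1 : ℂ) + (if (if h : i < n then α ⟨i, h⟩ else false) then -1 else 1) *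
          Complex.exp (2 * Real.pi * Complex.I *
            (((2 : ℝ) ^ i * (((-k).val : ℝ) / (N : ℝ)) : ℝ) : ℂ))‖ := by
  intro n N _ hN α k
  have hfun : (fun x : ZMod N =>
      ((∏ i : Fin n, (if α i && x.val.testBit (i : ℕ) then (-1 : ℝ) else 1) : ℝ) : ℂ)) =
      fun x : ZMod N => ∏ i ∈ range n,
        (if (if h : i < n then α ⟨i, h⟩ else false) && x.val.testBit i then (-1 : ℂ) else 1) :=
    funext fun x => heRieszBlock_sign_qReg_eq_range α x.val
  rw [hfun]
  exact heRieszBlock_norm_dft_le n hN (fun i => if h : i < n then α ⟨i, h⟩ else false) k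

end Summit.QuantumAdvantage.QuantumAdvantage.Theorems.SymplecticPurity
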